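import Summits.QuantumFields.YangMills.Theorems.BalabanUVNodesN07Eq26TermsAtRecordLetters
import HarnessLib

/-!
# N07 — THE CHART LETTER OF THE (47)-CARRYING CHART OF RECORD (spec (S1)) AND [15] (26) ALONG IT: `Ucur (unitsOfRecord (𝔖♭.chartLin T V A)) = prodCfg (Ucur (unitsOfRecord U₀)) η (curL Ŷ)`,
# hence `A^η(𝔖♭.chartLin T V A) = A^η(U₀) + N⁻¹·ℜ(⟨Ŷ, J⟩ + ½⟪ιY, Δ(U₀) ιY⟫ + V₀(curL Ŷ))` with `Y := T V (A + 𝔄V)` — (26)∕(74)-without-`π` at the record, ANY slot `T`, ANY `N`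

Cell `pub-ymgap`, seat `pub-ymgap-dag-n07-w3` (g29, WIDTH SEAT 3 on N07 [B11] = [15]); helper file keyed `--kind proof --supports stmt-QuantumFields-27238 --as helper` (K0ᴬ road);
count-neutral.  INTENT-8 of the seat; executes step (S1) of the seat's spec `EQ81-AT-RECORD-SPEC.g29.md` and composes it with ✓`N07Eq26TermsAtRecordLetters.wilsonAction4_eq26_atRecordLetters` (LANDED-7).

## What is here

* §1 ★ `ucur_unitsOfRecord_chartLin` — THE CHART LETTER: on an `SU(N)`-valued exponent (`hSU`, as in (A4) ✓`coe_chartLin_of_mem`), the lit transporters of the chart field are pv27's product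
  configuration `U′U₀`, `U′ = exp(iηŶ)` (✓`coe_unitsOfRecord`, ✓`bgSchemeOfRecord_ev`∕`_bg`∕`_𝔄`, ✓`evLit_apply`, `holonomy [X] = exp X`); `expoLinAt_mem_of_herm_traceless` — `hSU` from «`Ŷ` Hermitian and traceless»
  (✓`expoLinAt_mem_of_mem_lieSU`, ✓`mem_lieSU_iff`).
* §2 ★★★ `wilsonAction4_chartLin_eq26` — (26) ALONG THE CHART OF RECORD: for every slot `T`, field `V`, coordinate `A` with `Y := T V (A + 𝔄V)` Hermitian-presented and traceless,
  `A^η(𝔖♭.chartLin T V A) = A^η(U₀) + N⁻¹·ℜ( pair27 τRec J_rec Ŷ + ½⟪ιY, hessOpOfRecord ιY⟫_ℂ + V0 Tsh (Ucur (unitsOfRecord U₀)) η d tr (curL Ŷ) )`.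

## Honest labels

Bookkeeping; (26) is pv27's tautology defining `V₀` plus LANDED-7's dictionary; the BARE Hessian `Δ(U₀) = hessOpOfRecord` appears (print's (26)), NOT the slot-(c) `π†(Δ+Δ⁽²⁾)π` of (79)∕(81) — the
regrouping (78)–(81) on the Landau slice (spec (S4)) and the choice of `H` in the chart ∕ `W`-slot (RR-2's TRACE FLAG F-H, 2026-08-31: print's (45)∕(76) need `RD*H = 0`) are NOT addressed here and do not
affect this file (generic `T`, no `W`).  Nothing of Bałaban's estimates proved; K0ᴬ ⟨27238⟩ NOT closed; N07 NOT discharged; COUNT∕K UNMOVED; R4 is the conditional finite-𝕋⁴ rung `BalabanLadder.UV` only; finite torus at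
fixed `ε` — nothing continuum ∕ OS ∕ Clay.  **The Yang–Mills mass gap is NOT proved by any of this.**  No `sorry`, no `def`, no `instance ∕ notation ∕ set_option`; standard axioms.
[cite: Balaban1985Variational, (15) p.280, (19) p.281, (26)–(27) p.282, (47) p.285, (74) p.289; Balaban1985BackgroundPropagators, (3.1) p.390, (3.10)–(3.11) p.392]
-/

noncomputable section

open Set
open scoped Matrix Matrix.Norms.L2Operator InnerProductSpace ComplexConjugate

namespace Summit.QuantumFields.YangMills.Theorems.N07ChartLetterAtRecord

open Literature.MathematicalPhysics.QuantumFieldTheory.Balaban1983to89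
open Literature.MathematicalPhysics.QuantumFieldTheory.Balaban1983to89.T4Continuum (T4Family)
open Literature.MathematicalPhysics.QuantumFieldTheory.Balaban1983to89.Node00
open B9Eq37Insertion (holU val_holU)
open B9Eq39Adjoint (prodCfg fluct)
open B11Eq103H1Complex (SiteL2K BondL2K funEquiv)
open B11Eq111FrakG (nabla115)
open B11Eq115Space (NegSup JetSup)
open B11Eq90V0primeCurrent (Tsh Ucur curL curL_apply)
open B11Eq90Transpose (pair27)
open B11Eq26ActionExpansion (V0)
open Summit.QuantumFields.YangMills.Theorems.N07Eq26TermsAtRecordLetters (wilsonAction4_eq26_atRecordLetters)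

section Record

variable (F : T4Family) (N : ℕ) [NeZero N] {K : ℕ} (k : ℕ) (Ω : ℕ → Set (Site (F.P K) 0)) (U₀ : GaugeField (F.P K) 0 (SU N))
  [Fact (0 < (F.L : ℝ))] [Fact (0 < (F.P K).eta k)] (levB : PBond (F.P K) k → ℕ) [Fact (0 < c0Rec F K k)] [Fact (∀ c, 0 < wBRec F K k c)] (a : ℝ)
  (hposb : ∀ x, x ≠ 0 → 0 < RCLike.re ⟪x, laplaceAOfRecord F N k U₀ (QOfRecord F N k U₀) (QflatOfRecord F N k) a x⟫_ℂ)
  (hQ : Function.Surjective (QOfRecord F N k U₀)) (εC : ℝ)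
  (Gp : SiteL2K ℂ (F.P K).d (fun _ => (F.P K).sitesPerDir 0) (c0Rec F K k) (WRec N) →ₗ[ℂ]
    SiteL2K ℂ (F.P K).d (fun _ => (F.P K).sitesPerDir 0) (c0Rec F K k) (WRec N))
  (Δ2 : BondL2K ℂ (F.P K).d (fun _ => (F.P K).sitesPerDir 0) (c0Rec F K k) (WRec N) →ₗ[ℂ]
    BondL2K ℂ (F.P K).d (fun _ => (F.P K).sitesPerDir 0) (c0Rec F K k) (WRec N))
  (hposπ : ∀ x, x ≠ 0 → 0 < RCLike.re ⟪x, laplaceAOfRecordAt F N k U₀ (hessOpOfRecord128 F N k U₀ Gp (QflatOfRecord F N k) Δ2)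
    (QOfRecord F N k U₀) (QflatOfRecord F N k) a x⟫_ℂ)

/-- ★ **THE CHART LETTER (spec (S1))**: on an `SU(N)`-valued exponent, the lit transporters of the (47)-carrying chart field of the un-framed scheme of record are pv27's product
configuration `U′U₀` with `U′ = exp(iη Ŷ)`, `Ŷ` the presented field of the chart's exponent jet `T V (A + 𝔄V)`:
`Ucur (unitsOfRecord (𝔖♭.chartLin T V A)) = prodCfg (Ucur (unitsOfRecord U₀)) η (curL Ŷ)`. [cite: Balaban1985Variational, (15) p.280, (19) p.281, (47) p.285; Balaban1985BackgroundPropagators, p.390] -/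
theorem ucur_unitsOfRecord_chartLin (dom : Set (GaugeField (F.P K) k (SU N))) (B₀ C₄ a₃ j a𝔄 ε₄ : ℝ)
    (T : GaugeField (F.P K) k (SU N) → Space115Lit F N K k Ω U₀ → Space115Lit F N K k Ω U₀) (V : GaugeField (F.P K) k (SU N)) (A : Space115Lit F N K k Ω U₀)
    (hSU : ∀ b, (bgSchemeOfRecord F N K k Ω U₀ dom levB Gp Δ2 a hposπ hposb hQ εC B₀ C₄ a₃ j a𝔄 ε₄).expoLinAt T V A b ∈ Matrix.specialUnitaryGroup (Fin N) ℂ) :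
    Ucur (unitsOfRecord F N ((bgSchemeOfRecord F N K k Ω U₀ dom levB Gp Δ2 a hposπ hposb hQ εC B₀ C₄ a₃ j a𝔄 ε₄).chartLin T V A)) =
      prodCfg (Ucur (unitsOfRecord F N U₀)) ((F.P K).eta k)
        (curL (JetSup.equiv _ _ (nabla115 ((F.P K).eta k) (unitsOfRecord F N U₀)) (T V (A + frakAOfRecordAtBg128 F N K k Ω U₀ levB Gp Δ2 a hposπ hQ V)))) := by
  funext μ y
  apply Units.ext
  rw [show Ucur (unitsOfRecord F N ((bgSchemeOfRecord F N K k Ω U₀ dom levB Gp Δ2 a hposπ hposb hQ εC B₀ C₄ a₃ j a𝔄 ε₄).chartLin T V A)) μ y =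
      unitsOfRecord F N ((bgSchemeOfRecord F N K k Ω U₀ dom levB Gp Δ2 a hposπ hposb hQ εC B₀ C₄ a₃ j a𝔄 ε₄).chartLin T V A) (y, μ) from rfl,
    show prodCfg (Ucur (unitsOfRecord F N U₀)) ((F.P K).eta k)
        (curL (JetSup.equiv _ _ (nabla115 ((F.P K).eta k) (unitsOfRecord F N U₀)) (T V (A + frakAOfRecordAtBg128 F N K k Ω U₀ levB Gp Δ2 a hposπ hQ V)))) μ y =
      fluct ((F.P K).eta k) (curL (JetSup.equiv _ _ (nabla115 ((F.P K).eta k) (unitsOfRecord F N U₀)) (T V (A + frakAOfRecordAtBg128 F N K k Ω U₀ levB Gp Δ2 a hposπ hQ V)))) μ y *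
        unitsOfRecord F N U₀ (y, μ) from rfl,
    Units.val_mul, coe_unitsOfRecord, coe_unitsOfRecord, BgScheme.coe_chartLin_of_mem _ _ (hSU _), bgSchemeOfRecord_bg]
  simp only [fluct, val_holU, Beta.TransportVertices.holonomy, List.map_cons, List.map_nil, List.prod_cons, List.prod_nil, mul_one, curL_apply,
    BgScheme.expoLinAt, bgSchemeOfRecord_ev, bgSchemeOfRecord_𝔄, LinearMap.smul_apply, Pi.smul_apply, evLit_apply, Equiv.apply_symm_apply, smul_smul]


/-- `hSU` from reality: if the presented field `Ŷ` of the exponent jet `Y := T V (A + 𝔄V)` is Hermitian and traceless at every bond, the exponent is `SU(N)`-valued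
((A4) ✓`expoLinAt_mem_of_mem_lieSU`, ✓`mem_lieSU_iff`). [cite: Balaban1985Variational, (15) p.280, Prop. 6 p.295, Prop. 9 p.309] -/
theorem expoLinAt_mem_of_herm_traceless (dom : Set (GaugeField (F.P K) k (SU N))) (B₀ C₄ a₃ j a𝔄 ε₄ : ℝ)
    (T : GaugeField (F.P K) k (SU N) → Space115Lit F N K k Ω U₀ → Space115Lit F N K k Ω U₀) (V : GaugeField (F.P K) k (SU N)) (A : Space115Lit F N K k Ω U₀)
    (hY : ∀ b, star (JetSup.equiv _ _ (nabla115 ((F.P K).eta k) (unitsOfRecord F N U₀)) (T V (A + frakAOfRecordAtBg128 F N K k Ω U₀ levB Gp Δ2 a hposπ hQ V)) b) =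
      JetSup.equiv _ _ (nabla115 ((F.P K).eta k) (unitsOfRecord F N U₀)) (T V (A + frakAOfRecordAtBg128 F N K k Ω U₀ levB Gp Δ2 a hposπ hQ V)) b)
    (htr : ∀ b, Matrix.trace (JetSup.equiv _ _ (nabla115 ((F.P K).eta k) (unitsOfRecord F N U₀)) (T V (A + frakAOfRecordAtBg128 F N K k Ω U₀ levB Gp Δ2 a hposπ hQ V)) b) = 0)
    (b : PBond (F.P K) 0) :
    (bgSchemeOfRecord F N K k Ω U₀ dom levB Gp Δ2 a hposπ hposb hQ εC B₀ C₄ a₃ j a𝔄 ε₄).expoLinAt T V A b ∈ Matrix.specialUnitaryGroup (Fin N) ℂ := by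
  refine BgScheme.expoLinAt_mem_of_mem_lieSU _ _ (T4AdjointCovarianceUnitary.mem_lieSU_iff.2 ⟨?_, ?_⟩)
  · simp only [bgSchemeOfRecord_ev, bgSchemeOfRecord_𝔄, LinearMap.smul_apply, Pi.smul_apply, evLit_apply, smul_smul, star_smul, hY, star_mul, Complex.star_def,
      Complex.conj_I, Complex.conj_ofReal]
    rw [← neg_smul]
    congr 1
    ring
  · simp only [bgSchemeOfRecord_ev, bgSchemeOfRecord_𝔄, LinearMap.smul_apply, Pi.smul_apply, evLit_apply, smul_smul, Matrix.trace_smul, htr, smul_zero]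

/-! ## §2  (26) along the (47)-carrying chart of record -/

variable (ι : Space115Lit F N K k Ω U₀ ≃ₗ[ℂ] BondL2K ℂ (F.P K).d (fun _ => (F.P K).sitesPerDir 0) (c0Rec F K k) (WRec N))
  (hι : ∀ y, ι y = (funEquiv (phiRec N) (fun _ : B9SectCLatticeCarrier.Bond (F.P K).d (fun _ => (F.P K).sitesPerDir 0) => c0Rec F K k)).symm
    (JetSup.equiv _ _ (nabla115 ((F.P K).eta k) (unitsOfRecord F N U₀)) y))

include hι in
/-- ★★★ **[15] (26) ALONG THE (47)-CARRYING CHART OF RECORD** (any slot `T`, any `N`): with `Y := T V (A + 𝔄V)` Hermitian-presented and traceless,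
`A^η(𝔖♭.chartLin T V A) = A^η(U₀) + N⁻¹·ℜ( ⟨Ŷ, J⟩ + ½⟪ιY, Δ(U₀) ιY⟫_ℂ + V₀(curL Ŷ) )` — LANDED-7's ✓`wilsonAction4_eq26_atRecordLetters` at §1's chart letter.  This is print's (74) with the BARE `Δ(U₀)`
in place of `Δ_π` (they agree on `X = T47 A′` in the Landau slice when the chart's `H` has (45)'s `RD*H = 0` — spec (S4), TRACE FLAG F-H).
[cite: Balaban1985Variational, (26)–(27) p.282, (47) p.285, (74) p.289; Balaban1985BackgroundPropagators, (3.10)–(3.11) p.392] -/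
theorem wilsonAction4_chartLin_eq26 (dom : Set (GaugeField (F.P K) k (SU N))) (B₀ C₄ a₃ j a𝔄 ε₄ : ℝ)
    (T : GaugeField (F.P K) k (SU N) → Space115Lit F N K k Ω U₀ → Space115Lit F N K k Ω U₀) (V : GaugeField (F.P K) k (SU N)) (A : Space115Lit F N K k Ω U₀)
    (hY : ∀ b, star (JetSup.equiv _ _ (nabla115 ((F.P K).eta k) (unitsOfRecord F N U₀)) (T V (A + frakAOfRecordAtBg128 F N K k Ω U₀ levB Gp Δ2 a hposπ hQ V)) b) =
      JetSup.equiv _ _ (nabla115 ((F.P K).eta k) (unitsOfRecord F N U₀)) (T V (A + frakAOfRecordAtBg128 F N K k Ω U₀ levB Gp Δ2 a hposπ hQ V)) b)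
    (htr : ∀ b, Matrix.trace (JetSup.equiv _ _ (nabla115 ((F.P K).eta k) (unitsOfRecord F N U₀)) (T V (A + frakAOfRecordAtBg128 F N K k Ω U₀ levB Gp Δ2 a hposπ hQ V)) b) = 0) :
    wilsonAction4 ((bgSchemeOfRecord F N K k Ω U₀ dom levB Gp Δ2 a hposπ hposb hQ εC B₀ C₄ a₃ j a𝔄 ε₄).chartLin T V A) =
      wilsonAction4 U₀ + (N : ℝ)⁻¹ * RCLike.re
        (pair27 (tauRecCLM N) (JOfRecordAtBg F N K k Ω U₀)
            (JetSup.equiv _ _ (nabla115 ((F.P K).eta k) (unitsOfRecord F N U₀)) (T V (A + frakAOfRecordAtBg128 F N K k Ω U₀ levB Gp Δ2 a hposπ hQ V)))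
          + 2⁻¹ * ⟪ι (T V (A + frakAOfRecordAtBg128 F N K k Ω U₀ levB Gp Δ2 a hposπ hQ V)),
              hessOpOfRecord F N k U₀ (ι (T V (A + frakAOfRecordAtBg128 F N K k Ω U₀ levB Gp Δ2 a hposπ hQ V)))⟫_ℂ
          + V0 Tsh (Ucur (unitsOfRecord F N U₀)) ((F.P K).eta k) (F.P K).d (tauRec N)
              (curL (JetSup.equiv _ _ (nabla115 ((F.P K).eta k) (unitsOfRecord F N U₀)) (T V (A + frakAOfRecordAtBg128 F N K k Ω U₀ levB Gp Δ2 a hposπ hQ V))))) :=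
  wilsonAction4_eq26_atRecordLetters F N k Ω U₀ ι hι hY
    (ucur_unitsOfRecord_chartLin F N k Ω U₀ levB a hposb hQ εC Gp Δ2 hposπ dom B₀ C₄ a₃ j a𝔄 ε₄ T V A
      (expoLinAt_mem_of_herm_traceless F N k Ω U₀ levB a hposb hQ εC Gp Δ2 hposπ dom B₀ C₄ a₃ j a𝔄 ε₄ T V A hY htr))

end Record

end Summit.QuantumFields.YangMills.Theorems.N07ChartLetterAtRecord

end
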